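import Mathlib
import HarnessLib
import Summits.MatrixMultiplication.MatrixMultiplication.Theses.AutomaticSTPPDesigns
import Summits.MatrixMultiplication.MatrixMultiplication.Theses.GroupTheoreticSTPP
import Summits.MatrixMultiplication.MatrixMultiplication.Theorems.AutomaticSTPPDesignsAutomaticPackingThesisNormalForm
import Summits.MatrixMultiplication.MatrixMultiplication.Theorems.AutomaticSTPPDesignsAutomaticPackingThesisRankNormalForm
import Summits.MatrixMultiplication.MatrixMultiplication.Theorems.AutomaticSTPPDesignsAutomaticPackingThesisCruxGivesCThesis
import Literature.Computability.AlgebraicComplexity.PrattTrapezoidValSTPP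

/-!
# `AutomaticPackingThesis` — CYCLIC UNIVERSALITY: the crux is equivalent to route C's `CThesis`

Route `MatrixMultiplication/AutomaticSTPPDesigns`, crux `stmt-MatrixMultiplication-7356`
(`AutomaticPackingThesis`), crux-strategist redirect r1. Support file (`--supports`): it does not
close the crux; it proves the ASSEMBLY of the strategist's typed split

  `RankPackingLaw → InvariantFactorForm → CThesis → AutomaticPackingThesis`

(`AutomaticPackingThesis_of_subs`), whose first two hypotheses are unconditional, provable
statements (inlined verbatim as the split children's signatures) and whose third is the target
`CThesis` (X_C, stmt-MatrixMultiplication-0593) of route `GroupTheoreticSTPP`. Together with the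
tree theorem `cThesis_of_automaticPackingThesis` (crux → X_C) this gives, modulo the two provable
pieces, `AutomaticPackingThesis ↔ CThesis` (`automaticPackingThesis_iff_cThesis_of_subs`): the
cyclic (indeed 2-automatic) restriction of the abelian STPP programme costs nothing — "cyclic
groups are universal hosts for abelian STPP packings".

## The argument (Pratt 2024, proof of Thm. 4.4, run between the exponents `2/3` and `τ'` and
## over ALL finite abelian groups)

Fix `τ' > 2/3`; put `κ := log 3 / δ` and `τ := 2/3 + (τ' - 2/3)/(κ + 1)`, so that with
`θ := κ/(κ+1)` one has `τ = θ·(2/3) + (1-θ)·τ'` and `e^{-δθ} 3^{1-θ} = 1`.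
* X_C at `ε = 3τ - 2` gives a finite abelian `H` and an STPP family with `|H| < Σᵢ xᵢ^τ`,
  `xᵢ = |Aᵢ||Bᵢ||Cᵢ|` (and `|H| > 1`: nothing beats the trivial group, by the law at `r = 0`).
* `InvariantFactorForm`: `H ≃ ∏_{j<r} ℤ/d_j` (invariant factors) and `H ≃ (∏_{j<r} ℤ/p^{k_j}) × G`
  with all `k_j ≥ 1` (a prime `p` divides every invariant factor), the SAME `r`.
* `RankPackingLaw` (BCCGNSU 2017 Thm. 3.3 + Lemma 3.4 + Thm. 4.14 with a mixed-exponent low-weight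
  count, in powers): `Σᵢ xᵢ^{2/3} ≤ e^{-δ r}|H|` — the slice-rank saving is exponential in the
  p-RANK `r`, uniformly in the exponents `k_j`.
* Hölder (`Real.inner_le_Lp_mul_Lq_of_nonneg`): `Σ xᵢ^τ ≤ (Σ xᵢ^{2/3})^θ (Σ xᵢ^{τ'})^{1-θ}`, hence
  `Σ xᵢ^{τ'} > 3^r |H|` (else `Σ xᵢ^τ ≤ |H| e^{-δ r θ} 3^{r(1-θ)} = |H|`).
* Mixed radix (`exists_freiman3_pi_zmod`, tree): `x ↦ Σ_j x_j ∏_{l<j} 3d_l` reflects three-fold sums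
  into `ℤ/(3^r |H|)`, so the image family is STPP there (`exists_isSTPP_of_reflect`) with the same
  block sizes and beats its host at `τ'`; conclude by `automaticPackingThesis_iff_anyModulus`.

## References

* K. Pratt, *On generalized corners and matrix multiplication*, ITCS 2024, arXiv:2309.03878:
  Thm. 4.4 (the argument, for `ℤ_q^ℓ`, `q` a prime power, concluding `Val(ℤ_n) ≥ n^{1+c}`),
  Cor. 4.5 (boundedly many factors), Remark 4.6 (general abelian groups left open), p. 10.
* J. Blasiak, T. Church, H. Cohn, J. A. Grochow, E. Naslund, W. F. Sawin, C. Umans, *On cap sets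
  and the group-theoretic approach to matrix multiplication*, Discrete Analysis 2017:3,
  arXiv:1605.06702: Thm. 3.3, Lemma 3.4, Thm. 4.14 (p. 16), Thm. A′.
* H. Cohn, R. Kleinberg, B. Szegedy, C. Umans, FOCS 2005, arXiv:math/0511460: Def. 5.1, Thm. 5.5.
-/

-- single-conjunct summit: the mandated namespace repeats `MatrixMultiplication`.
set_option linter.dupNamespace false

noncomputable section

namespace Summit.MatrixMultiplication.MatrixMultiplication.Theorems

namespace AutomaticPackingThesis

open Finset Literature.Combinatorics.Additive Literature.Computability.AlgebraicComplexity
open Summit.MatrixMultiplication.MatrixMultiplication.Theses.AutomaticSTPPDesigns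
open Summit.MatrixMultiplication.MatrixMultiplication.Theses.GroupTheoreticSTPP (CThesis)

/-- `e^{-δθ}·3^{1-θ} = 1`-type bookkeeping: with `κ = log 3/δ`, `θ = κ/(κ+1)`,
`exp(-(δ r)) ^ θ * (3 ^ r) ^ (1 - θ) = 1`. [folklore] -/
theorem exp_rpow_mul_three_rpow_eq_one {δ : ℝ} (hδ : 0 < δ) (r : ℕ) :
    Real.exp (-(δ * r)) ^ (Real.log 3 / δ / (Real.log 3 / δ + 1)) *
      ((3 : ℝ) ^ r) ^ (1 - Real.log 3 / δ / (Real.log 3 / δ + 1)) = 1 := by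
  set κ : ℝ := Real.log 3 / δ with hκ
  have hlog3 : 0 < Real.log 3 := Real.log_pos (by norm_num)
  have hκ0 : 0 < κ := div_pos hlog3 hδ
  have hκ1 : (κ + 1) ≠ 0 := by linarith
  have h3 : ((3 : ℝ) ^ r) = Real.exp (Real.log 3 * r) := by
    rw [Real.exp_mul, Real.exp_log (by norm_num : (0 : ℝ) < 3), Real.rpow_natCast]
  rw [h3, ← Real.exp_mul, ← Real.exp_mul, ← Real.exp_add]
  have hδκ : δ * κ = Real.log 3 := by rw [hκ]; field_simp
  have : -(δ * r) * (κ / (κ + 1)) + Real.log 3 * r * (1 - κ / (κ + 1)) = 0 := by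
    rw [← hδκ]; field_simp; ring
  rw [this, Real.exp_zero]

/-- **Hölder between `2/3` and `τ'`** (log-convexity of `s ↦ Σ xᵢ^s`): for `xᵢ ≥ 0`, `0 < θ < 1`,
`Σ xᵢ^{θ a + (1-θ) b} ≤ (Σ xᵢ^a)^θ (Σ xᵢ^b)^{1-θ}` (`a, b > 0`).
[cite: Pratt2024, Thm. 4.4 (proof)] -/
theorem sum_rpow_interpolate {ι : Type*} (s : Finset ι) (x : ι → ℝ) (hx : ∀ i, 0 ≤ x i)
    {a b θ : ℝ} (ha : 0 < a) (hb : 0 < b) (hθ0 : 0 < θ) (hθ1 : θ < 1) :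
    ∑ i ∈ s, x i ^ (θ * a + (1 - θ) * b) ≤
      (∑ i ∈ s, x i ^ a) ^ θ * (∑ i ∈ s, x i ^ b) ^ (1 - θ) := by
  have h1θ : 0 < 1 - θ := by linarith
  have hpq := Real.holderConjugate_one_div hθ0 h1θ (by ring)
  have h := Real.inner_le_Lp_mul_Lq_of_nonneg s (f := fun i => x i ^ (a * θ))
    (g := fun i => x i ^ (b * (1 - θ))) hpq
    (fun i _ => Real.rpow_nonneg (hx i) _) (fun i _ => Real.rpow_nonneg (hx i) _)
  have hfg : ∀ i, x i ^ (a * θ) * x i ^ (b * (1 - θ)) = x i ^ (θ * a + (1 - θ) * b) := by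
    intro i
    have hne : a * θ + b * (1 - θ) ≠ 0 := by positivity
    rw [← Real.rpow_add' (hx i) hne]
    ring_nf
  have hf : ∀ i, (x i ^ (a * θ)) ^ (1 / θ) = x i ^ a := by
    intro i
    rw [← Real.rpow_mul (hx i)]
    congr 1
    field_simp
  have hg : ∀ i, (x i ^ (b * (1 - θ))) ^ (1 / (1 - θ)) = x i ^ b := by
    intro i
    rw [← Real.rpow_mul (hx i)]
    congr 1
    field_simp
  simp only [hfg, hf, hg, one_div_one_div] at h
  exact h

/-- **Assembly of the strategist's split (r1): `RankPackingLaw → InvariantFactorForm → CThesis →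
AutomaticPackingThesis`.** The abelian STPP thesis X_C of route `GroupTheoreticSTPP` implies the
crux: a witness of X_C at `τ = 2/3 + (τ'-2/3)/(κ+1)`, `κ = log 3/δ`, in ANY finite abelian group
`H` of p-rank `r` (number of invariant factors) has `Σ xᵢ^{2/3} ≤ e^{-δ r}|H|` (rank packing law),
hence by Hölder `Σ xᵢ^{τ'} > 3^r|H|`, which pays for the mixed-radix transfer to the cyclic group
`ℤ/(3^r|H|)` (`exists_freiman3_pi_zmod`, `exists_isSTPP_of_reflect`); the any-modulus normal form
`automaticPackingThesis_iff_anyModulus` concludes. The first two hypotheses are unconditional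
(BCCGNSU 2017 §3–4 with a mixed-exponent count; the structure theorem of finite abelian groups)
and are inlined verbatim as the split children's signatures.
[cite: Pratt2024, Thm. 4.4 (proof) and Remark 4.6]
[cite: BlasiakChurchCohnGrochowNaslundSawinUmans2017, Thm. 4.14] -/
theorem AutomaticPackingThesis_of_cThesis
    (h₁ : ∃ δ : ℝ, 0 < δ ∧ ∀ (p r : ℕ) (k : Fin r → ℕ), p.Prime → (∀ j, 1 ≤ k j) →
      ∀ (G : Type) [AddCommGroup G] [Fintype G] (H : Type) [AddCommGroup H] [Fintype H],
        Nonempty (H ≃+ (((j : Fin r) → ZMod (p ^ k j)) × G)) →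
        ∀ (N : ℕ) (A B C : Fin N → Finset H), Literature.Computability.AlgebraicComplexity.IsSTPP A B C →
          ∑ i, (((A i).card * (B i).card * (C i).card : ℕ) : ℝ) ^ ((2 : ℝ) / 3) ≤
            Real.exp (-(δ * r)) * (Fintype.card H : ℝ))
    (h₂ : ∀ (H : Type) [AddCommGroup H] [Fintype H], 1 < Fintype.card H →
      ∃ (p r : ℕ) (k d : Fin r → ℕ) (G : Type) (_ : AddCommGroup G) (_ : Fintype G),
        p.Prime ∧ (∀ j, 1 ≤ k j) ∧ (∀ j, 1 ≤ d j) ∧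
        Nonempty (H ≃+ ((j : Fin r) → ZMod (d j))) ∧
        Nonempty (H ≃+ (((j : Fin r) → ZMod (p ^ k j)) × G)))
    (h₃ : CThesis) : AutomaticPackingThesis := by
  classical
  obtain ⟨δ, hδ, hlaw⟩ := h₁
  rw [automaticPackingThesis_iff_anyModulus]
  intro τ' hτ'
  -- constants: κ = log 3 / δ, θ = κ/(κ+1), τ = 2/3 + (τ' - 2/3)/(κ+1)
  set κ : ℝ := Real.log 3 / δ with hκ
  have hlog3 : 0 < Real.log 3 := Real.log_pos (by norm_num)
  have hκ0 : 0 < κ := div_pos hlog3 hδ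
  have hκ1 : 0 < κ + 1 := by linarith
  set θ : ℝ := κ / (κ + 1) with hθ
  have hθ0 : 0 < θ := div_pos hκ0 hκ1
  have hθ1 : θ < 1 := (div_lt_one hκ1).2 (by linarith)
  set τ : ℝ := 2 / 3 + (τ' - 2 / 3) / (κ + 1) with hτ
  have hτ_gt : 2 / 3 < τ := by
    have : 0 < (τ' - 2 / 3) / (κ + 1) := div_pos (by linarith) hκ1
    linarith
  have hτconv : θ * (2 / 3) + (1 - θ) * τ' = τ := by
    rw [hθ, hτ]
    field_simp
    ring
  -- the X_C witness at ε = 3τ - 2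
  obtain ⟨H, _instH, _instF, N, A, B, C, hS0, hbeat⟩ := h₃ (3 * τ - 2) (by linarith)
  have hS : IsSTPP A B C := (isSTPP_iff A B C).2 hS0
  have hexp : (2 + (3 * τ - 2)) / 3 = τ := by ring
  rw [hexp] at hbeat
  set x : Fin N → ℝ := fun i => (((A i).card * (B i).card * (C i).card : ℕ) : ℝ) with hx
  have hx0 : ∀ i, 0 ≤ x i := fun i => Nat.cast_nonneg _
  have hHc : (0 : ℝ) < Fintype.card H := by exact_mod_cast Fintype.card_pos
  -- nothing beats the trivial group: |H| > 1 (the law at r = 0 gives Σ xᵢ^{2/3} ≤ |H| = 1, and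
  -- xᵢ ∈ {0,1} there, so Σ xᵢ^τ = Σ xᵢ^{2/3})
  have hH1 : 1 < Fintype.card H := by
    by_contra hle
    push Not at hle
    have hcard : Fintype.card H = 1 := le_antisymm hle Fintype.card_pos
    have e₀ : H ≃+ (((j : Fin 0) → ZMod (2 ^ (fun j : Fin 0 => 1) j)) × H) :=
      (AddEquiv.uniqueProd : (((j : Fin 0) → ZMod (2 ^ (fun j : Fin 0 => 1) j)) × H) ≃+ H).symm
    have h0 := hlaw 2 0 (fun _ => 1) Nat.prime_two (fun j => le_rfl) H H ⟨e₀⟩ N A B C hS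
    simp only [CharP.cast_eq_zero, mul_zero, neg_zero, Real.exp_zero, one_mul, hcard,
      Nat.cast_one] at h0
    -- each xᵢ ≤ 1, so xᵢ^τ = xᵢ^{2/3}
    have hxle : ∀ i, x i = 0 ∨ x i = 1 := by
      intro i
      have hA : (A i).card ≤ 1 := hcard ▸ Finset.card_le_univ (A i)
      have hB : (B i).card ≤ 1 := hcard ▸ Finset.card_le_univ (B i)
      have hC : (C i).card ≤ 1 := hcard ▸ Finset.card_le_univ (C i)
      have hprod : (A i).card * (B i).card * (C i).card ≤ 1 := by
        calc (A i).card * (B i).card * (C i).card ≤ 1 * 1 * 1 := by gcongr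
          _ = 1 := by norm_num
      rcases Nat.le_one_iff_eq_zero_or_eq_one.1 hprod with h | h
      · left
        show (((A i).card * (B i).card * (C i).card : ℕ) : ℝ) = 0
        rw [h, Nat.cast_zero]
      · right
        show (((A i).card * (B i).card * (C i).card : ℕ) : ℝ) = 1
        rw [h, Nat.cast_one]
    have hterm : ∀ i, x i ^ τ = x i ^ ((2 : ℝ) / 3) := by
      intro i
      rcases hxle i with h | h
      · rw [h, Real.zero_rpow (by linarith), Real.zero_rpow (by norm_num)]
      · rw [h, Real.one_rpow, Real.one_rpow]
    have hsum : ∑ i, x i ^ τ = ∑ i, x i ^ ((2 : ℝ) / 3) := Finset.sum_congr rfl fun i _ => hterm i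
    have hb : (1 : ℝ) < ∑ i, x i ^ τ := by
      have := hbeat; rw [hcard, Nat.cast_one] at this; exact this
    rw [hsum] at hb
    exact absurd (hb.trans_le h0) (lt_irrefl _)
  -- the two decompositions of H with the same r
  obtain ⟨p, r, k, d, G, _iG, _fG, hp, hk, hd, ⟨e₁⟩, ⟨e₂⟩⟩ := h₂ H hH1
  -- the rank packing law in H
  have hlawH : ∑ i, x i ^ ((2 : ℝ) / 3) ≤ Real.exp (-(δ * r)) * Fintype.card H :=
    hlaw p r k hp hk G H ⟨e₂⟩ N A B C hS
  -- ∏ d_j = |H|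
  haveI : ∀ j, NeZero (d j) := fun j => ⟨by have := hd j; omega⟩
  have hcardH : Fintype.card H = ∏ j, d j := by
    rw [Fintype.card_congr e₁.toEquiv, Fintype.card_pi]
    exact Finset.prod_congr rfl fun j _ => ZMod.card (d j)
  -- the mixed-radix transfer to ℤ/(3^r |H|)
  obtain ⟨ψ, hψ1, hψ2⟩ := exists_freiman3_pi_zmod r d (fun j => hd j)
  set M : ℕ := 3 ^ r * ∏ j, d j with hM
  have hM0 : 0 < M := Nat.mul_pos (pow_pos (by norm_num) r) (hcardH ▸ Fintype.card_pos)
  haveI : NeZero M := ⟨hM0.ne'⟩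
  have hφ : ∀ a b c a' b' c' : H,
      ((ψ (e₁ a) : ℕ) : ZMod M) + ((ψ (e₁ b) : ℕ) : ZMod M) + ((ψ (e₁ c) : ℕ) : ZMod M) =
        ((ψ (e₁ a') : ℕ) : ZMod M) + ((ψ (e₁ b') : ℕ) : ZMod M) + ((ψ (e₁ c') : ℕ) : ZMod M) →
      a + b + c = a' + b' + c' := by
    intro a b c a' b' c' he
    have he' : ((ψ (e₁ a) + ψ (e₁ b) + ψ (e₁ c) : ℕ) : ZMod M) =
        ((ψ (e₁ a') + ψ (e₁ b') + ψ (e₁ c') : ℕ) : ZMod M) := by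
      push_cast; exact he
    rw [ZMod.natCast_eq_natCast_iff', Nat.mod_eq_of_lt (hψ1 _ _ _),
      Nat.mod_eq_of_lt (hψ1 _ _ _)] at he'
    have h3 := hψ2 _ _ _ _ _ _ he'
    apply e₁.injective
    simpa only [map_add] using h3
  obtain ⟨A', B', C', hS', hcard'⟩ :=
    exists_isSTPP_of_reflect hS (fun h : H => ((ψ (e₁ h) : ℕ) : ZMod M)) hφ
  refine ⟨M, N, ?_, A', B', C', hS', ?_⟩
  · -- 2 ≤ |H| ≤ 3^r |H| = M
    calc 2 ≤ Fintype.card H := hH1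
      _ = 1 * ∏ j, d j := by rw [one_mul, hcardH]
      _ ≤ 3 ^ r * ∏ j, d j := Nat.mul_le_mul_right _ (Nat.one_le_pow _ _ (by norm_num))
  · -- beating at τ': by Hölder, else Σ xᵢ^τ ≤ |H|
    have hsum' : ∑ i, (((A' i).card * (B' i).card * (C' i).card : ℕ) : ℝ) ^ τ' =
        ∑ i, x i ^ τ' :=
      Finset.sum_congr rfl fun i _ => by rw [(hcard' i).1, (hcard' i).2.1, (hcard' i).2.2]
    rw [hsum']
    have hMR : (M : ℝ) = (3 : ℝ) ^ r * Fintype.card H := by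
      rw [hM, hcardH]; push_cast; ring
    rw [hMR]
    by_contra hcon
    push Not at hcon
    have hH : ∑ i, x i ^ τ ≤ (∑ i, x i ^ ((2 : ℝ) / 3)) ^ θ * (∑ i, x i ^ τ') ^ (1 - θ) := by
      have := sum_rpow_interpolate Finset.univ x hx0 (a := 2 / 3) (b := τ') (by norm_num)
        (by linarith) hθ0 hθ1
      rwa [hτconv] at this
    have h1θ : 0 ≤ 1 - θ := by linarith
    have hS23 : 0 ≤ ∑ i, x i ^ ((2 : ℝ) / 3) :=
      Finset.sum_nonneg fun i _ => Real.rpow_nonneg (hx0 i) _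
    have hSτ' : 0 ≤ ∑ i, x i ^ τ' := Finset.sum_nonneg fun i _ => Real.rpow_nonneg (hx0 i) _
    have hexp0 : 0 ≤ Real.exp (-(δ * r)) := (Real.exp_pos _).le
    have h3r : (0 : ℝ) ≤ (3 : ℝ) ^ r := by positivity
    have hbound : (∑ i, x i ^ ((2 : ℝ) / 3)) ^ θ * (∑ i, x i ^ τ') ^ (1 - θ) ≤
        (Real.exp (-(δ * r)) * Fintype.card H) ^ θ * ((3 : ℝ) ^ r * Fintype.card H) ^ (1 - θ) :=
      mul_le_mul (Real.rpow_le_rpow hS23 hlawH hθ0.le) (Real.rpow_le_rpow hSτ' hcon h1θ)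
        (Real.rpow_nonneg hSτ' _) (Real.rpow_nonneg (mul_nonneg hexp0 hHc.le) _)
    have hone : (Real.exp (-(δ * r)) * Fintype.card H) ^ θ *
        ((3 : ℝ) ^ r * Fintype.card H) ^ (1 - θ) = Fintype.card H := by
      rw [Real.mul_rpow hexp0 hHc.le, Real.mul_rpow h3r hHc.le]
      have hkey := exp_rpow_mul_three_rpow_eq_one hδ r
      rw [← hκ, ← hθ] at hkey
      calc Real.exp (-(δ * r)) ^ θ * (Fintype.card H : ℝ) ^ θ *
            (((3 : ℝ) ^ r) ^ (1 - θ) * (Fintype.card H : ℝ) ^ (1 - θ))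
          = (Real.exp (-(δ * r)) ^ θ * ((3 : ℝ) ^ r) ^ (1 - θ)) *
              ((Fintype.card H : ℝ) ^ θ * (Fintype.card H : ℝ) ^ (1 - θ)) := by ring
        _ = Fintype.card H := by
            rw [hkey, one_mul, ← Real.rpow_add hHc, add_sub_cancel, Real.rpow_one]
    have := (hbeat.trans_le hH).trans_le (hbound.trans_eq hone)
    exact lt_irrefl _ this

/-- **The split, verbatim** (`<CruxDecl>_of_subs` for `ledger route edit --split … --glue-by`): the
three hypotheses are the signatures of the split children `RankPackingLaw`, `InvariantFactorForm`,
`AbelianPackingThesis` (the last = the body of route C's `CThesis`, item stmt-MatrixMultiplication-0593,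
shared), the conclusion is the crux. [cite: Pratt2024, Thm. 4.4 (proof) and Remark 4.6] -/
theorem AutomaticPackingThesis_of_subs : (∃ δ : ℝ, 0 < δ ∧ ∀ (p r : ℕ) (k : Fin r → ℕ), p.Prime → (∀ j, 1 ≤ k j) → ∀ (G : Type) [AddCommGroup G] [Fintype G] (H : Type) [AddCommGroup H] [Fintype H], Nonempty (H ≃+ (((j : Fin r) → ZMod (p ^ k j)) × G)) → ∀ (N : ℕ) (A B C : Fin N → Finset H), Literature.Computability.AlgebraicComplexity.IsSTPP A B C → ∑ i, (((A i).card * (B i).card * (C i).card : ℕ) : ℝ) ^ ((2 : ℝ) / 3) ≤ Real.exp (-(δ * r)) * (Fintype.card H : ℝ)) → (∀ (H : Type) [AddCommGroup H] [Fintype H], 1 < Fintype.card H → ∃ (p r : ℕ) (k d : Fin r → ℕ) (G : Type) (_ : AddCommGroup G) (_ : Fintype G), p.Prime ∧ (∀ j, 1 ≤ k j) ∧ (∀ j, 1 ≤ d j) ∧ Nonempty (H ≃+ ((j : Fin r) → ZMod (d j))) ∧ Nonempty (H ≃+ (((j : Fin r) → ZMod (p ^ k j)) × G))) → (∀ ε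 : ℝ, 0 < ε → ∃ (H : Type) (_ : AddCommGroup H) (_ : Fintype H) (N : ℕ) (A B C : Fin N → Finset H), (∀ i j k : Fin N, ∀ s ∈ A k, ∀ s' ∈ A i, ∀ t ∈ B i, ∀ t' ∈ B j, ∀ u ∈ C j, ∀ u' ∈ C k, (s' - s) + (t' - t) + (u' - u) = 0 → i = j ∧ j = k ∧ s = s' ∧ t = t' ∧ u = u') ∧ (Fintype.card H : ℝ) < ∑ i, (((A i).card * (B i).card * (C i).card : ℕ) : ℝ) ^ ((2 + ε) / 3)) → AutomaticPackingThesis :=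
  fun h₁ h₂ h₃ => AutomaticPackingThesis_of_cThesis h₁ h₂ h₃

/-- **Cyclic universality, modulo the two provable pieces**: given the rank packing law and the
invariant-factor form, the crux `AutomaticPackingThesis` is EQUIVALENT to route C's abelian
thesis `CThesis` (X_C) — `→` is the tree theorem `cThesis_of_automaticPackingThesis`.
[cite: Pratt2024, Thm. 4.4 (proof) and Remark 4.6] -/
theorem automaticPackingThesis_iff_cThesis_of_subs
    (h₁ : ∃ δ : ℝ, 0 < δ ∧ ∀ (p r : ℕ) (k : Fin r → ℕ), p.Prime → (∀ j, 1 ≤ k j) →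
      ∀ (G : Type) [AddCommGroup G] [Fintype G] (H : Type) [AddCommGroup H] [Fintype H],
        Nonempty (H ≃+ (((j : Fin r) → ZMod (p ^ k j)) × G)) →
        ∀ (N : ℕ) (A B C : Fin N → Finset H), Literature.Computability.AlgebraicComplexity.IsSTPP A B C →
          ∑ i, (((A i).card * (B i).card * (C i).card : ℕ) : ℝ) ^ ((2 : ℝ) / 3) ≤
            Real.exp (-(δ * r)) * (Fintype.card H : ℝ))
    (h₂ : ∀ (H : Type) [AddCommGroup H] [Fintype H], 1 < Fintype.card H →
      ∃ (p r : ℕ) (k d : Fin r → ℕ) (G : Type) (_ : AddCommGroup G) (_ : Fintype G),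
        p.Prime ∧ (∀ j, 1 ≤ k j) ∧ (∀ j, 1 ≤ d j) ∧
        Nonempty (H ≃+ ((j : Fin r) → ZMod (d j))) ∧
        Nonempty (H ≃+ (((j : Fin r) → ZMod (p ^ k j)) × G))) :
    AutomaticPackingThesis ↔ CThesis :=
  ⟨cThesis_of_automaticPackingThesis, AutomaticPackingThesis_of_cThesis h₁ h₂⟩

end AutomaticPackingThesis

end Summit.MatrixMultiplication.MatrixMultiplication.Theorems

end
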